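import Literature.MeasureTheory.Group.ModularCharacterDirectFactor
import Literature.NumberTheory.Automorphic.UnitaryGroupPlaceInclusion
import Literature.NumberTheory.Automorphic.LocalUnitaryGroupCongrMeasure
import Literature.NumberTheory.Automorphic.LocalUnitaryGroupUnimodularIsotropic
import Literature.NumberTheory.Automorphic.AdelicUnitaryGroupUnimodularAnisotropic
import HarnessLib

/-!
# Local unimodularity from adelic unimodularity: `U(H)(L⁺_v)` is a direct factor of `U(H)(𝔸_{L⁺})`; rank-2 unitary groups are unimodular
# at every finite place
(Platonov–Rapinchuk, *Algebraic Groups and Number Theory* (1994), §5.1: `G_𝔸 = G_{F_v} × G_𝔸^{(v)}`; Folland (1995), §2.4 Prop. 2.27; Rogawski (1990),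
§3.8 Prop. 3.8.1 (a), §4.9: the centraliser `U(2) × U(1)` of a singular semisimple element and the measures of its orbital integrals)

Topic `NumberTheory/Automorphic`; namespace `Literature.NumberTheory.Automorphic.UnitaryGroup`.  THEOREMS ONLY (no def, no instance, no named fact,
no `sorry`).

* §1 **`modularCharacter_cmDatum_local_eq_one_of_adelic`**: if `U(H)(𝔸_{L⁺})` is unimodular then so is `U(H)(L⁺_v)` at EVERY finite `v` — the place-`v`
  inclusion ★ `inclPlaceAdelic v` (after ★ `localPiEquiv`) and the closed subgroup `{g | g_v = 1} = ker (evalPlace v ∘ finPart)` are commuting complements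
  (★ `exists_eq_mul_inclPlace`-style factorisation, ★ `commute_inclPlace_of_evalPlace_eq_one`, ★ `commute_archToAdelic_inclPlaceAdelic`), so ★
  `modularCharacterFun_eq_one_of_isComplement` (open mapping) applies.
* §2 rank 2: **`modularCharacter_cmDatum_local_two_eq_one`** — for `H ∈ M₂(L)` hermitian with `det H ≠ 0`, `U(H)(L⁺_v)` is unimodular at every
  finite `v`, by the GLOBAL dichotomy: `H` isotropic over `L` ⇒ ★ `modularCharacter_cmDatum_local_eq_one_of_isotropic`; `H` anisotropic over `L` ⇒
  `U(H)(𝔸_{L⁺})` unimodular (★ `modularCharacter_cmDatum_eq_one_of_anisotropic`, uniform lattice) ⇒ §1.  With `isMulRightInvariant_∕isInvInvariant_cmDatum_local_two`.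
  (No local compactness ∕ coercivity of anisotropic local unitary groups is used.)  This is the rank-2 block `U(H_a)(L⁺_v)` of the centraliser of a
  singular semisimple `γ ∈ U(3)` [Rogawski1990, Prop. 3.8.1 (a)], the input of the local orbital measures at singular classes.
* §3 `modularCharacter_cmDatum_local_eq_one_of_anisotropic` — anisotropic `H`, EVERY rank, every finite `v` (same route).

## References
* V. Platonov, A. Rapinchuk, *Algebraic Groups and Number Theory* (1994), §5.1 [PlatonovRapinchuk1994].
* G. B. Folland, *A Course in Abstract Harmonic Analysis* (1995), §2.4 Prop. 2.27 [Folland1995].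
* J. Rogawski, *Automorphic Representations of Unitary Groups in Three Variables* (1990), §3.8 Prop. 3.8.1 (a) p. 27, §4.9 p. 54 [Rogawski1990].
-/

noncomputable section

open MeasureTheory Measure NumberField IsDedekindDomain Topology
open Literature.MeasureTheory.Group
open Literature.AlgebraicGeometry.ShimuraVarieties (hermForm)
open scoped Matrix MatrixGroups NNReal

namespace Literature.NumberTheory.Automorphic

namespace UnitaryGroup

variable (L : Type) [Field L] [NumberField L] [IsCMField L] {N : ℕ} (H : Matrix (Fin N) (Fin N) L)
  (v : HeightOneSpectrum (𝓞 ↥(maximalRealSubfield L)))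

/-! ## §1 `U(H)(L⁺_v)` is an internal direct factor of `U(H)(𝔸_{L⁺})` -/

/-- **Local unimodularity from adelic unimodularity**: if the modular function of `U(H)(𝔸_{L⁺}) = (cmDatum L N H).Adelic` is trivial then so is
that of `U(H)(L⁺_v) = (cmDatum L N H).Local v` at every finite place `v` — `U(H)(L⁺_v) × {g | g_v = 1} ≃ₜ* U(H)(𝔸_{L⁺})` by the open mapping theorem
(★ `modularCharacterFun_eq_one_of_isComplement`; the maps are the generic datum's ★ `inclPlaceAdelic` ∕ `evalPlace` ∕ `finPart`, whose carriers ARE the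
`cmDatum` ones, ★ `adelicGroupData_eq_cmDatum`). [cite: PlatonovRapinchuk1994, §5.1] [cite: Folland1995, §2.4 Prop. 2.27] -/
theorem modularCharacter_cmDatum_local_eq_one_of_adelic (hA : ∀ g : (cmDatum L N H).Adelic, modularCharacter g = 1)
    (x : (cmDatum L N H).Local v) : modularCharacter x = 1 := by
  haveI : LocallyCompactSpace (adelicGroupData (↥(maximalRealSubfield L)) L (IsCMField.complexConj L) N H).Adelic := locallyCompactSpace_cmDatum_Adelic L N H
  haveI : SecondCountableTopology (adelicGroupData (↥(maximalRealSubfield L)) L (IsCMField.complexConj L) N H).Adelic := secondCountableTopology_cmDatum_Adelic L N H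
  haveI : T2Space (adelicGroupData (↥(maximalRealSubfield L)) L (IsCMField.complexConj L) N H).Adelic := t2Space_cmDatum_Adelic L N H
  have hπι : ∀ y : «local» L (IsCMField.complexConj L) N H v,
      localPiEquiv L (IsCMField.complexConj L) N H v (evalPlace (↥(maximalRealSubfield L)) L (IsCMField.complexConj L) N H v (finPart (↥(maximalRealSubfield L)) L (IsCMField.complexConj L) N H
        (inclPlaceAdelic (↥(maximalRealSubfield L)) L (IsCMField.complexConj L) N H v ((localPiEquiv L (IsCMField.complexConj L) N H v).symm y)))) = y := fun y => by
    rw [finPart_inclPlaceAdelic, evalPlace_inclPlace, ContinuousMulEquiv.apply_symm_apply]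
  -- `ι = inclPlaceAdelic ∘ localPiEquiv⁻¹`, `π = localPiEquiv ∘ evalPlace v ∘ finPart`
  have hιc : Continuous ((inclPlaceAdelic (↥(maximalRealSubfield L)) L (IsCMField.complexConj L) N H v).comp (localPiEquiv L (IsCMField.complexConj L) N H v).symm.toMonoidHom) :=
    (continuous_inclPlaceAdelic (↥(maximalRealSubfield L)) L (IsCMField.complexConj L) N H v).comp (localPiEquiv L (IsCMField.complexConj L) N H v).symm.continuous
  have hπc : Continuous ((localPiEquiv L (IsCMField.complexConj L) N H v).toMonoidHom.comp ((evalPlace (↥(maximalRealSubfield L)) L (IsCMField.complexConj L) N H v).comp (finPart (↥(maximalRealSubfield L)) L (IsCMField.complexConj L) N H))) :=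
    (localPiEquiv L (IsCMField.complexConj L) N H v).continuous.comp ((continuous_evalPlace (↥(maximalRealSubfield L)) L (IsCMField.complexConj L) N H v).comp (continuous_finPart (↥(maximalRealSubfield L)) L (IsCMField.complexConj L) N H))
  have hC : IsClosed ((((localPiEquiv L (IsCMField.complexConj L) N H v).toMonoidHom.comp ((evalPlace (↥(maximalRealSubfield L)) L (IsCMField.complexConj L) N H v).comp (finPart (↥(maximalRealSubfield L)) L (IsCMField.complexConj L) N H))).ker :
      Subgroup (adelicGroupData (↥(maximalRealSubfield L)) L (IsCMField.complexConj L) N H).Adelic) : Set (adelicGroupData (↥(maximalRealSubfield L)) L (IsCMField.complexConj L) N H).Adelic) := by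
    rw [MonoidHom.coe_ker]
    exact isClosed_singleton.preimage hπc
  have hker : ∀ g : (adelicGroupData (↥(maximalRealSubfield L)) L (IsCMField.complexConj L) N H).Adelic,
      g ∈ ((localPiEquiv L (IsCMField.complexConj L) N H v).toMonoidHom.comp ((evalPlace (↥(maximalRealSubfield L)) L (IsCMField.complexConj L) N H v).comp (finPart (↥(maximalRealSubfield L)) L (IsCMField.complexConj L) N H))).ker ↔
        evalPlace (↥(maximalRealSubfield L)) L (IsCMField.complexConj L) N H v (finPart (↥(maximalRealSubfield L)) L (IsCMField.complexConj L) N H g) = 1 := fun g => by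
    rw [MonoidHom.mem_ker]
    change localPiEquiv L (IsCMField.complexConj L) N H v (evalPlace (↥(maximalRealSubfield L)) L (IsCMField.complexConj L) N H v (finPart (↥(maximalRealSubfield L)) L (IsCMField.complexConj L) N H g)) = 1 ↔ _
    rw [← map_one (localPiEquiv L (IsCMField.complexConj L) N H v)]
    exact (localPiEquiv L (IsCMField.complexConj L) N H v).injective.eq_iff
  have hcomm : ∀ (n : «local» L (IsCMField.complexConj L) N H v) (g : (adelicGroupData (↥(maximalRealSubfield L)) L (IsCMField.complexConj L) N H).Adelic),
      g ∈ ((localPiEquiv L (IsCMField.complexConj L) N H v).toMonoidHom.comp ((evalPlace (↥(maximalRealSubfield L)) L (IsCMField.complexConj L) N H v).comp (finPart (↥(maximalRealSubfield L)) L (IsCMField.complexConj L) N H))).ker →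
      ((inclPlaceAdelic (↥(maximalRealSubfield L)) L (IsCMField.complexConj L) N H v).comp (localPiEquiv L (IsCMField.complexConj L) N H v).symm.toMonoidHom) n * g =
        g * ((inclPlaceAdelic (↥(maximalRealSubfield L)) L (IsCMField.complexConj L) N H v).comp (localPiEquiv L (IsCMField.complexConj L) N H v).symm.toMonoidHom) n := by
    intro n g hg
    have hg1 := (hker g).mp hg
    change inclPlaceAdelic (↥(maximalRealSubfield L)) L (IsCMField.complexConj L) N H v ((localPiEquiv L (IsCMField.complexConj L) N H v).symm n) * g = g * inclPlaceAdelic (↥(maximalRealSubfield L)) L (IsCMField.complexConj L) N H v ((localPiEquiv L (IsCMField.complexConj L) N H v).symm n)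
    have hdec := archToAdelic_mul_finAdelicToAdelic (↥(maximalRealSubfield L)) L (IsCMField.complexConj L) N H g
    rw [← hdec]
    have h1 : Commute (inclPlaceAdelic (↥(maximalRealSubfield L)) L (IsCMField.complexConj L) N H v ((localPiEquiv L (IsCMField.complexConj L) N H v).symm n))
        (archToAdelic (↥(maximalRealSubfield L)) L (IsCMField.complexConj L) N H (archPart (↥(maximalRealSubfield L)) L (IsCMField.complexConj L) N H g)) :=
      (commute_archToAdelic_inclPlaceAdelic (↥(maximalRealSubfield L)) L (IsCMField.complexConj L) N H (archPart (↥(maximalRealSubfield L)) L (IsCMField.complexConj L) N H g) v ((localPiEquiv L (IsCMField.complexConj L) N H v).symm n)).symm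
    have h2 : Commute (inclPlaceAdelic (↥(maximalRealSubfield L)) L (IsCMField.complexConj L) N H v ((localPiEquiv L (IsCMField.complexConj L) N H v).symm n))
        (finAdelicToAdelic (↥(maximalRealSubfield L)) L (IsCMField.complexConj L) N H (finPart (↥(maximalRealSubfield L)) L (IsCMField.complexConj L) N H g)) := by
      rw [inclPlaceAdelic_apply]
      have h := commute_inclPlace_of_evalPlace_eq_one (↥(maximalRealSubfield L)) L (IsCMField.complexConj L) N H (v := v) (g := finPart (↥(maximalRealSubfield L)) L (IsCMField.complexConj L) N H g) hg1 ((localPiEquiv L (IsCMField.complexConj L) N H v).symm n)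
      change finAdelicToAdelic (↥(maximalRealSubfield L)) L (IsCMField.complexConj L) N H (inclPlace (↥(maximalRealSubfield L)) L (IsCMField.complexConj L) N H v ((localPiEquiv L (IsCMField.complexConj L) N H v).symm n)) *
          finAdelicToAdelic (↥(maximalRealSubfield L)) L (IsCMField.complexConj L) N H (finPart (↥(maximalRealSubfield L)) L (IsCMField.complexConj L) N H g) =
        finAdelicToAdelic (↥(maximalRealSubfield L)) L (IsCMField.complexConj L) N H (finPart (↥(maximalRealSubfield L)) L (IsCMField.complexConj L) N H g) *
          finAdelicToAdelic (↥(maximalRealSubfield L)) L (IsCMField.complexConj L) N H (inclPlace (↥(maximalRealSubfield L)) L (IsCMField.complexConj L) N H v ((localPiEquiv L (IsCMField.complexConj L) N H v).symm n))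
      rw [← map_mul, ← map_mul, h.eq]
    exact (h1.mul_right h2).eq
  have hbij : Function.Bijective fun p : («local» L (IsCMField.complexConj L) N H v) ×
      (((localPiEquiv L (IsCMField.complexConj L) N H v).toMonoidHom.comp ((evalPlace (↥(maximalRealSubfield L)) L (IsCMField.complexConj L) N H v).comp (finPart (↥(maximalRealSubfield L)) L (IsCMField.complexConj L) N H))).ker :
        Subgroup (adelicGroupData (↥(maximalRealSubfield L)) L (IsCMField.complexConj L) N H).Adelic) =>
      ((inclPlaceAdelic (↥(maximalRealSubfield L)) L (IsCMField.complexConj L) N H v).comp (localPiEquiv L (IsCMField.complexConj L) N H v).symm.toMonoidHom) p.1 *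
        (p.2 : (adelicGroupData (↥(maximalRealSubfield L)) L (IsCMField.complexConj L) N H).Adelic) := by
    constructor
    · rintro ⟨n, g⟩ ⟨n', g'⟩ hp
      have hp' : inclPlaceAdelic (↥(maximalRealSubfield L)) L (IsCMField.complexConj L) N H v ((localPiEquiv L (IsCMField.complexConj L) N H v).symm n) * (g : (adelicGroupData (↥(maximalRealSubfield L)) L (IsCMField.complexConj L) N H).Adelic) =
          inclPlaceAdelic (↥(maximalRealSubfield L)) L (IsCMField.complexConj L) N H v ((localPiEquiv L (IsCMField.complexConj L) N H v).symm n') * (g' : (adelicGroupData (↥(maximalRealSubfield L)) L (IsCMField.complexConj L) N H).Adelic) := hp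
      have hn : n = n' := by
        have h := congrArg (fun z => localPiEquiv L (IsCMField.complexConj L) N H v (evalPlace (↥(maximalRealSubfield L)) L (IsCMField.complexConj L) N H v (finPart (↥(maximalRealSubfield L)) L (IsCMField.complexConj L) N H z))) hp'
        simp only [map_mul, hπι, (hker _).mp g.2, (hker _).mp g'.2, mul_one] at h
        exact h
      subst hn
      have hg : (g : (adelicGroupData (↥(maximalRealSubfield L)) L (IsCMField.complexConj L) N H).Adelic) = g' := mul_left_cancel hp'
      exact Prod.ext rfl (Subtype.ext hg)
    · intro g
      refine ⟨(localPiEquiv L (IsCMField.complexConj L) N H v (evalPlace (↥(maximalRealSubfield L)) L (IsCMField.complexConj L) N H v (finPart (↥(maximalRealSubfield L)) L (IsCMField.complexConj L) N H g)),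
        ⟨(inclPlaceAdelic (↥(maximalRealSubfield L)) L (IsCMField.complexConj L) N H v ((localPiEquiv L (IsCMField.complexConj L) N H v).symm
          (localPiEquiv L (IsCMField.complexConj L) N H v (evalPlace (↥(maximalRealSubfield L)) L (IsCMField.complexConj L) N H v (finPart (↥(maximalRealSubfield L)) L (IsCMField.complexConj L) N H g)))))⁻¹ * g, (hker _).mpr ?_⟩), ?_⟩
      · rw [map_mul, map_inv, map_mul, map_inv, ContinuousMulEquiv.symm_apply_apply, finPart_inclPlaceAdelic, evalPlace_inclPlace, inv_mul_cancel]
      · change inclPlaceAdelic (↥(maximalRealSubfield L)) L (IsCMField.complexConj L) N H v ((localPiEquiv L (IsCMField.complexConj L) N H v).symm _) * ((inclPlaceAdelic (↥(maximalRealSubfield L)) L (IsCMField.complexConj L) N H v ((localPiEquiv L (IsCMField.complexConj L) N H v).symm _))⁻¹ * g) = g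
        rw [mul_inv_cancel_left]
  exact modularCharacterFun_eq_one_of_isComplement _ hιc _ hC hcomm hbij hA x

/-- Every Haar measure on `U(H)(L⁺_v)` is right invariant when `U(H)(𝔸_{L⁺})` is unimodular. [cite: PlatonovRapinchuk1994, §5.1] -/
theorem isMulRightInvariant_cmDatum_local_of_adelic (hA : ∀ g : (cmDatum L N H).Adelic, modularCharacter g = 1)
    [MeasurableSpace ((cmDatum L N H).Local v)] [BorelSpace ((cmDatum L N H).Local v)] (ν : Measure ((cmDatum L N H).Local v))
    [ν.IsHaarMeasure] : ν.IsMulRightInvariant :=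
  isMulRightInvariant_of_modularCharacterFun_eq_one (fun x => modularCharacter_cmDatum_local_eq_one_of_adelic L H v hA x) ν

/-! ## §2 Anisotropic `H`, every rank; rank 2, every `H` -/

/-- **`U(H)(L⁺_v)` is unimodular at every finite `v` for ANISOTROPIC `H`, every rank** (★ `modularCharacter_cmDatum_eq_one_of_anisotropic`: uniform
lattice `U(H)(L⁺) ≤ U(H)(𝔸)`; then §1). [cite: Rogawski1990, §4.9 p. 54] [cite: PlatonovRapinchuk1994, §5.1] -/
theorem modularCharacter_cmDatum_local_eq_one_of_anisotropic' (hanis : ∀ x : Fin N → L, hermForm (cmConjRingHom L) H x x = 0 → x = 0)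
    (x : (cmDatum L N H).Local v) : modularCharacter x = 1 :=
  modularCharacter_cmDatum_local_eq_one_of_adelic L H v (modularCharacter_cmDatum_eq_one_of_anisotropic L H hanis) x

/-- **Rank 2: `U(H)(L⁺_v)` is unimodular at EVERY finite `v` for every hermitian `H ∈ M₂(L)` with `det H ≠ 0`** — global dichotomy: `H` isotropic
over `L` (a rational isotropic vector; ★ `modularCharacter_cmDatum_local_eq_one_of_isotropic`) or anisotropic (adelic unimodularity, §1).  The `U(2)` block
of the centraliser `U(H_a) × U(H_b)` of a singular semisimple element of `U(3)`. [cite: Rogawski1990, §3.8 Prop. 3.8.1 (a) p. 27; §4.9 p. 54] -/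
theorem modularCharacter_cmDatum_local_two_eq_one (H₂ : Matrix (Fin 2) (Fin 2) L) (hH : (H₂.map (cmConjRingHom L))ᵀ = H₂) (hdet : H₂.det ≠ 0)
    (x : (cmDatum L 2 H₂).Local v) : modularCharacter x = 1 := by
  by_cases hanis : ∀ y : Fin 2 → L, hermForm (cmConjRingHom L) H₂ y y = 0 → y = 0
  · exact modularCharacter_cmDatum_local_eq_one_of_anisotropic' L H₂ v hanis x
  · push Not at hanis
    obtain ⟨y, hy, hy0⟩ := hanis
    refine modularCharacter_cmDatum_local_eq_one_of_isotropic L two_ne_zero H₂ hH hdet ⟨y, hy0, ?_⟩ v x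
    simpa [hermForm, cmConjRingHom_apply, dotProduct, Matrix.mulVec] using hy

/-- Every Haar measure on `U(H₂)(L⁺_v)` (rank 2, `det H₂ ≠ 0`) is right invariant. [cite: Rogawski1990, §4.9 p. 54] -/
theorem isMulRightInvariant_cmDatum_local_two (H₂ : Matrix (Fin 2) (Fin 2) L) (hH : (H₂.map (cmConjRingHom L))ᵀ = H₂) (hdet : H₂.det ≠ 0)
    [MeasurableSpace ((cmDatum L 2 H₂).Local v)] [BorelSpace ((cmDatum L 2 H₂).Local v)] (ν : Measure ((cmDatum L 2 H₂).Local v))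
    [ν.IsHaarMeasure] : ν.IsMulRightInvariant :=
  isMulRightInvariant_of_modularCharacterFun_eq_one (fun x => modularCharacter_cmDatum_local_two_eq_one L v H₂ hH hdet x) ν

/-- Every Haar measure on `U(H₂)(L⁺_v)` (rank 2, `det H₂ ≠ 0`) is inversion invariant. [cite: Rogawski1990, §4.9 p. 54] -/
theorem isInvInvariant_cmDatum_local_two (H₂ : Matrix (Fin 2) (Fin 2) L) (hH : (H₂.map (cmConjRingHom L))ᵀ = H₂) (hdet : H₂.det ≠ 0)
    [MeasurableSpace ((cmDatum L 2 H₂).Local v)] [BorelSpace ((cmDatum L 2 H₂).Local v)] (ν : Measure ((cmDatum L 2 H₂).Local v))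
    [ν.IsHaarMeasure] : ν.IsInvInvariant := by
  haveI := isMulRightInvariant_cmDatum_local_two L v H₂ hH hdet ν
  exact isInvInvariant_of_isMulRightInvariant ν

/-! ## §3 (ED. 2) Anisotropic `H`, every rank: right and inversion invariance of the local Haar measures -/

/-- Every Haar measure on `U(H)(L⁺_v)` is right invariant for ANISOTROPIC `H` (every rank, every finite `v`; ★
`modularCharacter_cmDatum_local_eq_one_of_anisotropic'`). [cite: Rogawski1990, §4.9 p. 54] [cite: PlatonovRapinchuk1994, §5.1] -/
theorem isMulRightInvariant_cmDatum_local_of_anisotropic (hanis : ∀ x : Fin N → L, hermForm (cmConjRingHom L) H x x = 0 → x = 0)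
    [MeasurableSpace ((cmDatum L N H).Local v)] [BorelSpace ((cmDatum L N H).Local v)] (ν : Measure ((cmDatum L N H).Local v))
    [ν.IsHaarMeasure] : ν.IsMulRightInvariant :=
  isMulRightInvariant_of_modularCharacterFun_eq_one (fun x => modularCharacter_cmDatum_local_eq_one_of_anisotropic' L H v hanis x) ν

/-- **Every Haar measure on `U(H)(L⁺_v)` is inversion invariant for ANISOTROPIC `H`** (every rank, every finite `v`) — the unimodularity input of the
involution `f ↦ f^*` on `C_c(U(H)(L⁺_v))` (e.g. the `*`-character property of spherical Hecke eigencharacters, ★ `SphericalEigencharacterStarCharacter`).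
[cite: Rogawski1990, §4.9 p. 54] [cite: PlatonovRapinchuk1994, §5.1] -/
theorem isInvInvariant_cmDatum_local_of_anisotropic (hanis : ∀ x : Fin N → L, hermForm (cmConjRingHom L) H x x = 0 → x = 0)
    [MeasurableSpace ((cmDatum L N H).Local v)] [BorelSpace ((cmDatum L N H).Local v)] (ν : Measure ((cmDatum L N H).Local v))
    [ν.IsHaarMeasure] : ν.IsInvInvariant := by
  haveI := isMulRightInvariant_cmDatum_local_of_anisotropic L H v hanis ν
  exact isInvInvariant_of_isMulRightInvariant ν

end UnitaryGroup

end Literature.NumberTheory.Automorphic
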